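import Summits.BirchSwinnertonDyer.Rank1Residual.GaloisImage.KolyvaginFiniteSingularGlueFrobenius
import Summits.BirchSwinnertonDyer.Rank1Residual.GaloisImage.KolyvaginFiniteSingularRatInertia
import Summits.BirchSwinnertonDyer.Rank1Residual.GaloisImage.KolyvaginFiniteSingularTorsionPrelims
import Summits.BirchSwinnertonDyer.Rank1Residual.GaloisImage.KolyvaginComparisonOperatorTorsion
import Literature.NumberTheory.EllipticCurves.GoodReductionUnramifiedProofs
import HarnessLib

/-!
# The finite–singular relation `loc^s_q κ_{rq} = φ^{fs}_q (loc_q κ_r)` for Kolyvagin's derivative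
# classes of an Euler system of `T_p E / ℚ`, read in `H¹(ℚ, E[m])`
# (cell `b2b-bsdres`, n1011 p11 GEN 10; row T-DER, file C5b-β: THEOREM C ∘ (C5a, C5b-α) — the
# `fs_rel` clause of `KolyvaginDatum.IsKolyvaginSystem` for the ES-derived family)

HONEST FRAMING (cell `b2b-bsdres`, run/shared/lean/b2b/bsd-rank1-residual/, verbatim in every
file): the goal of the cell is to DELETE the COMBINATION-SHAPED residual classes of the
Birch–Swinnerton-Dyer formula for ALL analytic-rank `≤ 1` elliptic curves over `ℚ` — "full BSD
formula for every rank `≤ 1` curve in class `C`" assembled STRICTLY from published theorems — so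
that the rank-`≤ 1` remainder becomes exactly the CONSTRUCTION-SHAPED classes, which are TYPED
(missing-input `Prop`s), NOT attempted. This is not "finishing BSD". Team n1011: research route on
the CONSTRUCTION-SHAPED class X4 / §I N11 (route-1 PORT, (P-DER)); TOOL theorems: NO Euler system
is asserted to exist (it is the hypothesis `hc`), no definition, no named fact, no `sorry`.

## What

Fix an Euler system `c` of `T = T_p E` over the cyclotomic levels `ℚ(μ_{p^{i+1} r})` of `ℚ`
(`hc : IsEulerSystem (cyclotomicLevelsRat p S) T p c` — a HYPOTHESIS), a `ℤ_p`-linear quotient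
`red : T ⟶ T′` (`hred` onto) killed by `p^n` (`hM`), read in `E[m]` through an additive continuous
equivariant bijection `e : T′ → E[m]` (`he`, `einv`, `h₁`, `h₂`), `m = p^n` (`hm`) — the
INSTANCE-FREE form of `T′ = E[p^n]` (GZ-2 `TorsionCoeff.torsionRepPadicInt`, `red = tateModuleRed`,
`e` = the identity; cf. GZ-4 `TorsionPadicIntCoefficientsLocal`) — and a Kolyvagin datum `D` on
`E[m]` whose comparison maps ARE the canonical ones for the primitive roots `η`
(`hD : D.HasCanonicalComparison (p^n) η`).  Let `q ∈ 𝒫(D)`, `q ∉ r`, be a Kolyvagin prime of level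
`n` (`hKol`), the generators `σ_ℓ` chosen as in E4a (`hσ hcov hinj`, `σ_q ∈ I_{𝔓₀}`,
`χ_{Nq}(σ_q) = η_q`, `𝔓₀ = adicCompletionPrime ℚ q`), `E[m]^{Gal(ℚ̄/ℚ(μ_{rq}))} = 0` (`h0`), and let
`κ′, κ ∈ H¹(ℚ, E[m])` be the derivative classes at the levels `rq` and `r`: the classes
restricting to `D_{rq} (Φ_{U′} (red_* c_{rq}))`, `D_r (Φ_U (red_* c_r))` for transports `Φ_{U′}`,
`Φ_U` computed on cocycles by `e` (GZ-1; GZ-2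
`TorsionCoeff.Rat.exists_sigma_existsUnique_res_eq_deriv_torsionGaloisModule`).  Then
**`loc^s_q κ′ = φ^{fs}_q (loc_q κ)`** (`KolyvaginDatum.singularLocalization _ q κ′ =
D.fsLocalization q κ`) — the `fs_rel` clause of `IsKolyvaginSystem` (Rubin, *Euler Systems*
Thm. 4.5.4; Mazur–Rubin App. A, Thm. A.4 with Def. 1.2.2; Kim §2.2.2), GIVEN the identity
`e (Q(ρ_{T′}(φ⁻¹)) y) = comparisonOp (p^n) φ (e y)` between THEOREM C's operator and the tree's
`comparisonOp` on `E[m]` at the Kolyvagin prime `q` (`hQop`; n1011-p13's C5b (i)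
`TorsionComparison.map_aeval_eq_comparisonOp_of_isKolyvaginPrime`).
Proof: pull `κ′, κ` back to `H¹(ℚ, T′)` along the GZ-1 isomorphism (the characterisations pull
back by injectivity of `Φ_U`, as in GZ-2), take representatives `Φ, Φ_r`, push them to `E[m]`;
THEOREM C at any inertia lift (E4b `apply_eq_aeval_apply_of_mem_inertia_of_eulerSystem`) at an
arithmetic Frobenius `φ₁ ∈ Gal(ℚ̄/ℚ(μ_q))` at `𝔓₀` (C5b-α) gives the cocycle form, C5b-α
`FS.singularLocalization_eq_fsLocalization_of_apply_eq` the relation.  Discharged inside: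
`T′` unramified at `q` (Silverman VII.4.1 on `E[m]`, through `e`), `P_q(ρ_{T′}(φ₁⁻¹)) = 0`
(`P_q(Fr⁻¹) = (q−1)·Z` on `T_pE`, K4/E3a, and `p^n ∣ q − 1`), `σ_q⁻¹τ ∈ Gal(ℚ̄/ℚ(μ_q))`, the local
inertia element of character `η_q`.
0 defs, 0 facts.  References: K. Rubin, *Euler Systems* (2000), Def. 4.4.1, Thm. 4.5.4;
B. Mazur, K. Rubin, Mem. AMS 799 (2004), Def. 1.2.2, App. A Thm. A.4; K. Rubin, PCMI 18 (2011),
Def. 1.9.6; C.-H. Kim, arXiv:2203.12159, §2.1.2–§2.2.2; J. Silverman, *AEC*, Prop. VII.4.1.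
-/

noncomputable section

open CategoryTheory Function Finset Polynomial Field IsDedekindDomain
open scoped NumberField
open Literature.NumberTheory.GaloisRepresentations Literature.NumberTheory.EllipticCurves
open Literature.NumberTheory.GaloisRepresentations.DiscreteGaloisModule
open Literature.NumberTheory.GaloisRepresentations.IsNonarchimedeanLocalField
open Literature.NumberTheory.GaloisCohomology
open Summit.BirchSwinnertonDyer.Rank1Residual.GaloisImage.CoeffTransport
open Summit.BirchSwinnertonDyer.Rank1Residual.GaloisImage.CyclotomicLevel
open Rat.HeightOneSpectrum

universe u v w

/-! ## The `fs_rel` clause for the derivative classes of an Euler system of `T_p E`, in `E[m]` -/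

namespace Summit.BirchSwinnertonDyer.Rank1Residual.GaloisImage.Derivative.Rat

variable (W : WeierstrassCurve ℚ) [W.IsElliptic] [W.IsGloballyMinimal] (p : ℕ) [Fact p.Prime]
variable [Module.Free ℤ_[p] (W.tateModule p)] [Module.Finite ℤ_[p] (W.tateModule p)]
  [ContinuousSMul ℤ_[p] (W.tateModule p)]

/-- Local notation: `T∞ = T_p E` as a continuous `G_ℚ`-representation. -/
local notation3 "T∞" => WeierstrassCurve.tateGaloisRep W p (W.continuous_galoisRepTate_holds p)

/-- Local notation: `𝐫⟦f, T′, U⟧ = f_* : H¹(U, T_pE) → H¹(U, T′)`. -/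
local notation3 (prettyPrint := false) "𝐫⟦" f ", " Tg ", " U "⟧" =>
  ContinuousCohomology.map (ContinuousMonoidHom.id _)
    (X := subgroupRep (ContinuousRep.toTopRep T∞) U)
    (Y := subgroupRep (ContinuousRep.toTopRep Tg) U)
    ((TopRep.resFunctor (Subgroup.subtype U)).map f) 1

variable (S : Set (HeightOneSpectrum (𝓞 ℚ)))

/-- Local notation: `𝓛` = the cyclotomic Euler-system levels `ℚ(μ_{p^{n+1}}, μ_r)`, `r ∩ S = ∅`. -/
local notation3 "𝓛" => cyclotomicLevelsRat p S

/-- Local notation: `𝐃⟦A, X, U, τ⟧ ℓ = ∑_{j < ℓ−1} j·(τ_ℓ)_*^j`, Kolyvagin's derivative operator of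
the place `ℓ` on `H¹(U, X)` (`A`-linear) for the generator `τ_ℓ`. -/
local notation3 (prettyPrint := false) "𝐃⟦" A ", " X ", " U ", " τ "⟧" =>
  fun ℓ : HeightOneSpectrum (𝓞 ℚ) =>
  ∑ j ∈ Finset.range (((primesEquiv ℓ : Nat.Primes) : ℕ) - 1),
    (j : Module.End A (continuousCohomology 1 (subgroupRep X U))) *
      (conjMap X U ((τ : HeightOneSpectrum (𝓞 ℚ) → absoluteGaloisGroup ℚ) ℓ) 1).hom.toLinearMap ^ j

/-- Local notation: `𝐏⟦φ⟧ = P(φ⁻¹ | T_pE^*; X)`, Rubin's Euler factor. -/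
local notation3 "𝐏⟦" φ "⟧" =>
  rubinEulerFactor (WeierstrassCurve.galoisRepTate W p) (cyclotomicCharacterToUnits ℚ p ℤ_[p]) φ

/-- **The `fs_rel` clause for Kolyvagin's derivative classes of an Euler system of `T_p E`, read in
`H¹(ℚ, E[m])`, GIVEN the operator identity `hQop`** (see the module docstring for every binder):
`loc^s_q κ′ = φ^{fs}_q (loc_q κ)`.
[cite: Rubin2000, Thm. 4.5.4] [cite: MazurRubin2004, App. A, Thm. A.4 and Def. 1.2.2]
[cite: Kim2022StructureSelmer, §2.2.2] -/
theorem singularLocalization_eq_fsLocalization_of_eulerSystem_of_comparisonOp (hp2 : p ≠ 2)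
    {c : ∀ (i : ℕ) (r : (𝓛).Ideals), H1 T∞ ((𝓛).level i r.1)}
    (hc : IsEulerSystem 𝓛 T∞ p c)
    {M' : Type} [AddCommGroup M'] [Module ℤ_[p] M'] [TopologicalSpace M'] [IsTopologicalAddGroup M']
    [ContinuousSMul ℤ_[p] M'] {T' : GaloisRep ℚ ℤ_[p] M'} (red : T∞.toTopRep ⟶ T'.toTopRep)
    (hred : Function.Surjective red.hom)
    {n : ℕ} (hn : 0 < n) (hM : ∀ m : M', ((p : ℤ_[p]) ^ n) • m = 0)
    {m : ℤ} (hm : m = ((p ^ n : ℕ) : ℤ))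
    [Module (ZMod (p ^ n)) (WeierstrassCurve.geomTorsion W m)]
    [Module.Free (ZMod (p ^ n)) (WeierstrassCurve.geomTorsion W m)]
    [Module.Finite (ZMod (p ^ n)) (WeierstrassCurve.geomTorsion W m)]
    (e : M' →+ WeierstrassCurve.geomTorsion W m) (hec : Continuous e)
    (he : ∀ (g : absoluteGaloisGroup ℚ) (x : M'),
      e (T'.toTopRep.ρ g x) = (W.torsionGaloisModule m).toTopRep.ρ g (e x))
    (einv : WeierstrassCurve.geomTorsion W m →+ M') (hic : Continuous einv)
    (h₁ : ∀ x, einv (e x) = x) (h₂ : ∀ y, e (einv y) = y)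
    (r : (𝓛).Ideals) {q : HeightOneSpectrum (𝓞 ℚ)} (hq : q ∈ (𝓛).primes) (hqr : q ∉ r.1)
    (hKol : Kato.IsKolyvaginPrime W p n ((primesEquiv q : Nat.Primes) : ℕ))
    (D : KolyvaginDatum (W.torsionGaloisModule m))
    {η : (ℓ : HeightOneSpectrum (𝓞 ℚ)) → (ZMod (Ideal.absNorm ℓ.asIdeal))ˣ}
    (hD : D.HasCanonicalComparison (p ^ n) η) (hqD : q ∈ D.primes)
    (σ : HeightOneSpectrum (𝓞 ℚ) → absoluteGaloisGroup ℚ)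
    (hσ : ∀ ℓ ∈ (r.cons q hq).1, ∀ ℓ₂ ∈ (r.cons q hq).1, ℓ₂ ≠ ℓ → σ ℓ ∈ (𝓛).tameLevel ℓ₂)
    (hcov : ∀ ℓ ∈ (r.cons q hq).1, ∀ g : absoluteGaloisGroup ℚ,
      ∃ j < ((primesEquiv ℓ : Nat.Primes) : ℕ) - 1, (σ ℓ ^ j)⁻¹ * g ∈ (𝓛).tameLevel ℓ)
    (hinj : ∀ ℓ ∈ (r.cons q hq).1, ∀ j₁ < ((primesEquiv ℓ : Nat.Primes) : ℕ) - 1,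
      ∀ j₂ < ((primesEquiv ℓ : Nat.Primes) : ℕ) - 1,
        (σ ℓ ^ j₁)⁻¹ * σ ℓ ^ j₂ ∈ (𝓛).tameLevel ℓ → j₁ = j₂)
    (hσI : σ q ∈ (adicCompletionPrime ℚ q).inertia (absoluteGaloisGroup ℚ))
    (hσχ : modNCyclotomicCharacter ℚ (Ideal.absNorm q.asIdeal) (σ q) = η q)
    (h0 : ∀ P : WeierstrassCurve.geomTorsion W m,
      (∀ u : (𝓛).level ⊥ (r.cons q hq).1, (u : absoluteGaloisGroup ℚ) • P = P) → P = 0)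
    {φ₁ : absoluteGaloisGroup ℚ} (hφ₁ : IsArithFrobAt (𝓞 ℚ) φ₁ (adicCompletionPrime ℚ q))
    (hφ₁q : φ₁ ∈ (𝓛).tameLevel q)
    (Q : ℤ_[p][X]) (hQ : (Polynomial.X - C 1) * Q = 𝐏⟦φ₁⟧ - C (𝐏⟦φ₁⟧.eval 1))
    (hQop : ∀ y : M', e (aeval ((T'.toTopRep.ρ φ₁⁻¹ : M' →L[ℤ_[p]] M') : Module.End ℤ_[p] M') Q y) =
      (W.torsionGaloisModule m).comparisonOp (p ^ n) φ₁ (e y))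
    (ΦU' : continuousCohomology 1 (subgroupRep T'.toTopRep ((𝓛).level ⊥ (r.cons q hq).1)) →+
      continuousCohomology 1 (subgroupRep (W.torsionGaloisModule m).toTopRep
        ((𝓛).level ⊥ (r.cons q hq).1)))
    (hΦU' : ∀ (φ : contOneCocycles (subgroupRep T'.toTopRep ((𝓛).level ⊥ (r.cons q hq).1)))
      (ψ : contOneCocycles (subgroupRep (W.torsionGaloisModule m).toTopRep
        ((𝓛).level ⊥ (r.cons q hq).1))),
      (∀ g, ψ.1 g = e (φ.1 g)) → ΦU' (oneCocycleClass _ φ) = oneCocycleClass _ ψ)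
    (ΦU : continuousCohomology 1 (subgroupRep T'.toTopRep ((𝓛).level ⊥ r.1)) →+
      continuousCohomology 1 (subgroupRep (W.torsionGaloisModule m).toTopRep ((𝓛).level ⊥ r.1)))
    (hΦU : ∀ (φ : contOneCocycles (subgroupRep T'.toTopRep ((𝓛).level ⊥ r.1)))
      (ψ : contOneCocycles (subgroupRep (W.torsionGaloisModule m).toTopRep ((𝓛).level ⊥ r.1))),
      (∀ g, ψ.1 g = e (φ.1 g)) → ΦU (oneCocycleClass _ φ) = oneCocycleClass _ ψ)
    (comm') (κ' : galoisCohomology (W.torsionGaloisModule m) 1)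
    (hκ' : resSubgroup (W.torsionGaloisModule m).toTopRep ((𝓛).level ⊥ (r.cons q hq).1) 1 κ' =
      ((r.cons q hq).1.noncommProd
        𝐃⟦ℤ, (W.torsionGaloisModule m).toTopRep, ((𝓛).level ⊥ (r.cons q hq).1), σ⟧ comm')
        (ΦU' (𝐫⟦red, T', ((𝓛).level ⊥ (r.cons q hq).1)⟧ (c ⊥ (r.cons q hq)))))
    (comm) (κ : galoisCohomology (W.torsionGaloisModule m) 1)
    (hκ : resSubgroup (W.torsionGaloisModule m).toTopRep ((𝓛).level ⊥ r.1) 1 κ =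
      (r.1.noncommProd 𝐃⟦ℤ, (W.torsionGaloisModule m).toTopRep, ((𝓛).level ⊥ r.1), σ⟧ comm)
        (ΦU (𝐫⟦red, T', ((𝓛).level ⊥ r.1)⟧ (c ⊥ r)))) :
    KolyvaginDatum.singularLocalization (W.torsionGaloisModule m) q κ' = D.fsLocalization q κ := by
  classical
  have h𝔓₀ : adicCompletionPrime ℚ q ∈ q.primesAbove := adicCompletionPrime_mem_primesAbove ℚ q
  -- the Kolyvagin prime
  have hq'p : ((primesEquiv q : Nat.Primes) : ℕ).Prime := (primesEquiv q).2
  have hne : ((primesEquiv q : Nat.Primes) : ℕ) ≠ p := hKol.ne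
  have hgood : W.HasGoodReductionAt q :=
    CyclotomicLevel.Rat.hasGoodReductionAt_of_isKolyvaginPrime W hKol
  have hpv : ((p : ℕ) : 𝓞 ℚ) ∉ q.asIdeal :=
    Rat.natCast_not_mem_asIdeal_of_not_dvd fun h =>
      hne ((Nat.prime_dvd_prime_iff_eq hq'p (Fact.out : p.Prime)).mp h)
  have hmv : ((m : ℤ) : 𝓞 ℚ) ∉ q.asIdeal := by
    rw [hm, Int.cast_natCast, Nat.cast_pow]
    exact fun h => hpv (q.isPrime.mem_of_pow_mem n h)
  -- `E[m]` and `T′` are unramified at `q`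
  have hI : ∀ τ ∈ (adicCompletionPrime ℚ q).inertia (absoluteGaloisGroup ℚ),
      ∀ w : WeierstrassCurve.geomTorsion W m, W.torsionGaloisModule m τ w = w := fun τ hτ w => by
    rw [WeierstrassCurve.torsionGaloisModule_apply_apply]
    exact W.smul_geomTorsion_eq_of_mem_inertia hgood hmv h𝔓₀ hτ w
  have hX'I : ∀ u ∈ (adicCompletionPrime ℚ q).inertia (absoluteGaloisGroup ℚ), ∀ w : M',
      T'.toTopRep.ρ u w = w := fun u hu w => by
    have h := he u w
    rw [show (W.torsionGaloisModule m).toTopRep.ρ u (e w) = e w from hI u hu (e w)] at h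
    have h' := congrArg einv h
    rwa [h₁, h₁] at h'
  -- `h0` in `T′`-currency
  have h0' : ∀ v : T'.toTopRep, (∀ u : ((𝓛).level ⊥ (r.cons q hq).1),
      T'.toTopRep.ρ (u : absoluteGaloisGroup ℚ) v = v) → v = 0 := by
    intro v hv
    have h := h0 (e v) fun u => by
      have := congrArg e (hv u)
      rw [he] at this
      exact this
    have := congrArg einv h
    rwa [h₁, map_zero] at this
  -- the global transport and the pulled-back classes
  obtain ⟨Φ₀, hΦ₀⟩ := exists_addEquiv_oneCocycleClass T'.toTopRep (W.torsionGaloisModule m).toTopRep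
    e hec he einv hic h₁ h₂
  have commX' := pairwise_commute_deriv (L := 𝓛) (T' := T') ⊥ (r.cons q hq).1 σ
    (fun ℓ => ((primesEquiv ℓ : Nat.Primes) : ℕ) - 1)
  have commX := pairwise_commute_deriv (L := 𝓛) (T' := T') ⊥ r.1 σ
    (fun ℓ => ((primesEquiv ℓ : Nat.Primes) : ℕ) - 1)
  have hκ'X : resSubgroup T'.toTopRep ((𝓛).level ⊥ (r.cons q hq).1) 1 (Φ₀.symm κ') =
      ((r.cons q hq).1.noncommProd 𝐃⟦ℤ_[p], T'.toTopRep, ((𝓛).level ⊥ (r.cons q hq).1), σ⟧ commX')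
        (𝐫⟦red, T', ((𝓛).level ⊥ (r.cons q hq).1)⟧ (c ⊥ (r.cons q hq))) :=
    resSubgroup_symm_eq_noncommProd_deriv T'.toTopRep (W.torsionGaloisModule m).toTopRep e hec he
      einv h₁ h₂ ((𝓛).level ⊥ (r.cons q hq).1) Φ₀ hΦ₀ ΦU' hΦU' σ _ (r.cons q hq).1 commX' comm' _
      κ' hκ'
  have hκX : resSubgroup T'.toTopRep ((𝓛).level ⊥ r.1) 1 (Φ₀.symm κ) =
      (r.1.noncommProd 𝐃⟦ℤ_[p], T'.toTopRep, ((𝓛).level ⊥ r.1), σ⟧ commX)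
        (𝐫⟦red, T', ((𝓛).level ⊥ r.1)⟧ (c ⊥ r)) :=
    resSubgroup_symm_eq_noncommProd_deriv T'.toTopRep (W.torsionGaloisModule m).toTopRep e hec he
      einv h₁ h₂ ((𝓛).level ⊥ r.1) Φ₀ hΦ₀ ΦU hΦU σ _ r.1 commX comm _ κ hκ
  -- representatives and their push-forwards
  obtain ⟨Φ, hΦ⟩ := oneCocycleClass_surjective T'.toTopRep (Φ₀.symm κ')
  obtain ⟨Φr, hΦr⟩ := oneCocycleClass_surjective T'.toTopRep (Φ₀.symm κ)
  obtain ⟨Ψ, hΨ⟩ : ∃ Ψ : contOneCocycles (W.torsionGaloisModule m).toTopRep,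
      ∀ g, Ψ.1 g = e (Φ.1 g) :=
    ⟨⟨_, comp_mem_contOneCocycles T'.toTopRep (W.torsionGaloisModule m).toTopRep e hec he Φ⟩,
      fun _ => rfl⟩
  obtain ⟨Ψr, hΨr⟩ : ∃ Ψr : contOneCocycles (W.torsionGaloisModule m).toTopRep,
      ∀ g, Ψr.1 g = e (Φr.1 g) :=
    ⟨⟨_, comp_mem_contOneCocycles T'.toTopRep (W.torsionGaloisModule m).toTopRep e hec he Φr⟩,
      fun _ => rfl⟩
  have hκ'Ψ : κ' = oneCocycleClass (W.torsionGaloisModule m).toTopRep Ψ := by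
    rw [← hΦ₀ Φ Ψ hΨ, hΦ, AddEquiv.apply_symm_apply]
  have hκΨr : κ = oneCocycleClass (W.torsionGaloisModule m).toTopRep Ψr := by
    rw [← hΦ₀ Φr Ψr hΨr, hΦr, AddEquiv.apply_symm_apply]
  rw [hκ'Ψ, hκΨr]
  -- inertia at `q` lies in `U_r = Gal(ℚ̄/ℚ(μ_r))`
  have hrq : ∀ ℓ ∈ r.1, ℓ ≠ q := fun ℓ hℓ h => hqr (h ▸ hℓ)
  have hIU : ∀ τ ∈ (adicCompletionPrime ℚ q).inertia (absoluteGaloisGroup ℚ),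
      τ ∈ ((𝓛).level ⊥ r.1) := fun τ hτ =>
    mem_level_of_forall 𝓛 (by rw [(𝓛).pLevel_bot]; exact Subgroup.mem_top _)
      fun ℓ hℓ => CyclotomicLevel.Rat.mem_tameLevel_of_mem_inertia p S h𝔓₀ hτ (hrq ℓ hℓ)
  -- `Φ_r` kills `I_{𝔓₀}` (E4b: the weights of Frobenius on `T_pE`)
  have commT : ((r.1 : Finset _) : Set (HeightOneSpectrum (𝓞 ℚ))).Pairwise fun a b =>
      Commute (𝐃⟦ℤ_[p], T∞.toTopRep, ((𝓛).level ⊥ r.1), σ⟧ a)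
        (𝐃⟦ℤ_[p], T∞.toTopRep, ((𝓛).level ⊥ r.1), σ⟧ b) :=
    pairwise_commute_deriv (T' := T∞) ⊥ r.1 σ (fun ℓ => ((primesEquiv ℓ : Nat.Primes) : ℕ) - 1)
  have hresr : resSubgroup T'.toTopRep ((𝓛).level ⊥ r.1) 1 (oneCocycleClass _ Φr) =
      𝐫⟦red, T', ((𝓛).level ⊥ r.1)⟧
        ((r.1.noncommProd 𝐃⟦ℤ_[p], T∞.toTopRep, ((𝓛).level ⊥ r.1), σ⟧ commT) (c ⊥ r)) := by
    rw [hΦr, hκX]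
    exact (apply_noncommProd_apply_eq_of_comm (𝐫⟦red, T', ((𝓛).level ⊥ r.1)⟧).hom.toLinearMap
      r.1 commT commX
      (fun ℓ _ v => apply_deriv_apply_eq_of_comm _ (fun w => red_conjMap red (σ ℓ) w) _ v)
      (c ⊥ r)).symm
  have hΦrI : ∀ τ ∈ (adicCompletionPrime ℚ q).inertia (absoluteGaloisGroup ℚ), Φr.1 τ = 0 :=
    fun τ hτ => apply_eq_zero_of_mem_inertia_of_resSubgroup_eq W p ((𝓛).isOpen_level ⊥ _) hpv
      hgood h𝔓₀ red hX'I _ Φr hresr hτ (hIU τ hτ)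
  have hΨrI : ∀ τ ∈ (adicCompletionPrime ℚ q).inertia (absoluteGaloisGroup ℚ), Ψr.1 τ = 0 :=
    fun τ hτ => by rw [hΨr, hΦrI τ hτ, map_zero]
  -- a local inertia element of character `η_q`
  obtain ⟨τ₀, hτ₀I, hτ₀⟩ :=
    CyclotomicLevel.Rat.exists_mem_absInertia_localNormCyclotomicCharacter_eq q (η q)
  -- `P_q(ρ_{T′}(φ₁⁻¹)) = 0`
  have hPX : ∀ w : M',
      aeval ((T'.toTopRep.ρ φ₁⁻¹ : M' →L[ℤ_[p]] M') : Module.End ℤ_[p] M') 𝐏⟦φ₁⟧ w = 0 :=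
    aeval_rubinEulerFactor_apply_eq_zero_of_isKolyvaginPrime W p red hred hM hKol
      ⟨adicCompletionPrime ℚ q, h𝔓₀, hφ₁⟩
  -- THEOREM C at every inertia lift `τ` of `σ_q`, pushed to `E[m]`
  refine FS.singularLocalization_eq_fsLocalization_of_apply_eq (W.torsionGaloisModule m) (p ^ n) D
    hD hqD hI Ψ Ψr hΨrI hφ₁ (fun τ hτ hχ => ?_) hτ₀I hτ₀
  have hτσ : (σ q)⁻¹ * τ ∈ (𝓛).tameLevel q :=
    CyclotomicLevel.Rat.inv_mul_mem_tameLevel_of_modNCyclotomicCharacter_absNorm_eq p S q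
      (hσχ.trans hχ.symm)
  have hC := apply_eq_aeval_apply_of_mem_inertia_of_eulerSystem W p S hp2 hc red hn hM r hq hqr
    hKol σ hσ hcov hinj h𝔓₀ hσI hφ₁ hφ₁q h0' hX'I hPX Q hQ commX' (Φ₀.symm κ') hκ'X commX
    (Φ₀.symm κ) hκX Φ hΦ Φr hΦr hτ hτσ
  rw [hΨ, hC, hQop, ← hΨr]

/-- **THE `fs_rel` CLAUSE for Kolyvagin's derivative classes of an Euler system of `T_p E`, read in
`H¹(ℚ, E[m])`** (every binder in the module docstring; no operator hypothesis): for the derivative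
classes `κ′` (level `rq`) and `κ` (level `r`) of `red_* c` pushed to `E[m]`,
**`loc^s_q κ′ = φ^{fs}_q (loc_q κ)`** — `KolyvaginDatum.singularLocalization _ q κ′ = D.fsLocalization q κ`.
THEOREM C (row T-DER, E4b) + the glue C5a/C5b-α + n1011-p13's operator identity
`TorsionComparison.map_aeval_eq_comparisonOp_of_isKolyvaginPrime` at an arithmetic Frobenius
`φ₁ ∈ Gal(ℚ̄/ℚ(μ_q))` at `𝔓₀` (C5b-α `CyclotomicLevel.Rat.exists_isArithFrobAt_mem_tameLevel`).
[cite: Rubin2000, Thm. 4.5.4] [cite: MazurRubin2004, App. A, Thm. A.4 and Def. 1.2.2]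
[cite: Rubin2011, Def. 1.9.6 (p. 14)] [cite: Kim2022StructureSelmer, §2.2.2] -/
theorem singularLocalization_eq_fsLocalization_of_eulerSystem (hp2 : p ≠ 2)
    {c : ∀ (i : ℕ) (r : (𝓛).Ideals), H1 T∞ ((𝓛).level i r.1)}
    (hc : IsEulerSystem 𝓛 T∞ p c)
    {M' : Type} [AddCommGroup M'] [Module ℤ_[p] M'] [TopologicalSpace M'] [IsTopologicalAddGroup M']
    [ContinuousSMul ℤ_[p] M'] {T' : GaloisRep ℚ ℤ_[p] M'} (red : T∞.toTopRep ⟶ T'.toTopRep)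
    (hred : Function.Surjective red.hom)
    {n : ℕ} (hn : 0 < n) (hM : ∀ m : M', ((p : ℤ_[p]) ^ n) • m = 0)
    {m : ℤ} (hm : m = ((p ^ n : ℕ) : ℤ))
    [Module (ZMod (p ^ n)) (WeierstrassCurve.geomTorsion W m)]
    [Module.Free (ZMod (p ^ n)) (WeierstrassCurve.geomTorsion W m)]
    [Module.Finite (ZMod (p ^ n)) (WeierstrassCurve.geomTorsion W m)]
    (e : M' →+ WeierstrassCurve.geomTorsion W m) (hec : Continuous e)
    (he : ∀ (g : absoluteGaloisGroup ℚ) (x : M'),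
      e (T'.toTopRep.ρ g x) = (W.torsionGaloisModule m).toTopRep.ρ g (e x))
    (einv : WeierstrassCurve.geomTorsion W m →+ M') (hic : Continuous einv)
    (h₁ : ∀ x, einv (e x) = x) (h₂ : ∀ y, e (einv y) = y)
    (r : (𝓛).Ideals) {q : HeightOneSpectrum (𝓞 ℚ)} (hq : q ∈ (𝓛).primes) (hqr : q ∉ r.1)
    (hKol : Kato.IsKolyvaginPrime W p n ((primesEquiv q : Nat.Primes) : ℕ))
    (D : KolyvaginDatum (W.torsionGaloisModule m))
    {η : (ℓ : HeightOneSpectrum (𝓞 ℚ)) → (ZMod (Ideal.absNorm ℓ.asIdeal))ˣ}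
    (hD : D.HasCanonicalComparison (p ^ n) η) (hqD : q ∈ D.primes)
    (σ : HeightOneSpectrum (𝓞 ℚ) → absoluteGaloisGroup ℚ)
    (hσ : ∀ ℓ ∈ (r.cons q hq).1, ∀ ℓ₂ ∈ (r.cons q hq).1, ℓ₂ ≠ ℓ → σ ℓ ∈ (𝓛).tameLevel ℓ₂)
    (hcov : ∀ ℓ ∈ (r.cons q hq).1, ∀ g : absoluteGaloisGroup ℚ,
      ∃ j < ((primesEquiv ℓ : Nat.Primes) : ℕ) - 1, (σ ℓ ^ j)⁻¹ * g ∈ (𝓛).tameLevel ℓ)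
    (hinj : ∀ ℓ ∈ (r.cons q hq).1, ∀ j₁ < ((primesEquiv ℓ : Nat.Primes) : ℕ) - 1,
      ∀ j₂ < ((primesEquiv ℓ : Nat.Primes) : ℕ) - 1,
        (σ ℓ ^ j₁)⁻¹ * σ ℓ ^ j₂ ∈ (𝓛).tameLevel ℓ → j₁ = j₂)
    (hσI : σ q ∈ (adicCompletionPrime ℚ q).inertia (absoluteGaloisGroup ℚ))
    (hσχ : modNCyclotomicCharacter ℚ (Ideal.absNorm q.asIdeal) (σ q) = η q)
    (h0 : ∀ P : WeierstrassCurve.geomTorsion W m,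
      (∀ u : (𝓛).level ⊥ (r.cons q hq).1, (u : absoluteGaloisGroup ℚ) • P = P) → P = 0)
    (ΦU' : continuousCohomology 1 (subgroupRep T'.toTopRep ((𝓛).level ⊥ (r.cons q hq).1)) →+
      continuousCohomology 1 (subgroupRep (W.torsionGaloisModule m).toTopRep
        ((𝓛).level ⊥ (r.cons q hq).1)))
    (hΦU' : ∀ (φ : contOneCocycles (subgroupRep T'.toTopRep ((𝓛).level ⊥ (r.cons q hq).1)))
      (ψ : contOneCocycles (subgroupRep (W.torsionGaloisModule m).toTopRep
        ((𝓛).level ⊥ (r.cons q hq).1))),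
      (∀ g, ψ.1 g = e (φ.1 g)) → ΦU' (oneCocycleClass _ φ) = oneCocycleClass _ ψ)
    (ΦU : continuousCohomology 1 (subgroupRep T'.toTopRep ((𝓛).level ⊥ r.1)) →+
      continuousCohomology 1 (subgroupRep (W.torsionGaloisModule m).toTopRep ((𝓛).level ⊥ r.1)))
    (hΦU : ∀ (φ : contOneCocycles (subgroupRep T'.toTopRep ((𝓛).level ⊥ r.1)))
      (ψ : contOneCocycles (subgroupRep (W.torsionGaloisModule m).toTopRep ((𝓛).level ⊥ r.1))),
      (∀ g, ψ.1 g = e (φ.1 g)) → ΦU (oneCocycleClass _ φ) = oneCocycleClass _ ψ)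
    (comm') (κ' : galoisCohomology (W.torsionGaloisModule m) 1)
    (hκ' : resSubgroup (W.torsionGaloisModule m).toTopRep ((𝓛).level ⊥ (r.cons q hq).1) 1 κ' =
      ((r.cons q hq).1.noncommProd
        𝐃⟦ℤ, (W.torsionGaloisModule m).toTopRep, ((𝓛).level ⊥ (r.cons q hq).1), σ⟧ comm')
        (ΦU' (𝐫⟦red, T', ((𝓛).level ⊥ (r.cons q hq).1)⟧ (c ⊥ (r.cons q hq)))))
    (comm) (κ : galoisCohomology (W.torsionGaloisModule m) 1)
    (hκ : resSubgroup (W.torsionGaloisModule m).toTopRep ((𝓛).level ⊥ r.1) 1 κ =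
      (r.1.noncommProd 𝐃⟦ℤ, (W.torsionGaloisModule m).toTopRep, ((𝓛).level ⊥ r.1), σ⟧ comm)
        (ΦU (𝐫⟦red, T', ((𝓛).level ⊥ r.1)⟧ (c ⊥ r)))) :
    KolyvaginDatum.singularLocalization (W.torsionGaloisModule m) q κ' = D.fsLocalization q κ := by
  -- an arithmetic Frobenius at `𝔓₀` fixing `μ_q`
  obtain ⟨φ₁, hφ₁, hφ₁q⟩ := CyclotomicLevel.Rat.exists_isArithFrobAt_mem_tameLevel p S q
    (adicCompletionPrime_mem_primesAbove ℚ q)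
  -- Rubin's `Q` for THEOREM C
  obtain ⟨Q, hQ⟩ := X_sub_C_dvd_sub_C_eval (p := 𝐏⟦φ₁⟧) (a := (1 : ℤ_[p]))
  -- the operator identity (n1011-p13, C5b (i))
  have hQop : ∀ y : M',
      e (aeval ((T'.toTopRep.ρ φ₁⁻¹ : M' →L[ℤ_[p]] M') : Module.End ℤ_[p] M') Q y) =
        (W.torsionGaloisModule m).comparisonOp (p ^ n) φ₁ (e y) := fun y =>
    TorsionComparison.map_aeval_eq_comparisonOp_of_isKolyvaginPrime W p n hm hKol
      ⟨adicCompletionPrime ℚ q, adicCompletionPrime_mem_primesAbove ℚ q, hφ₁⟩ Q hQ.symm _ e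
      (fun s z => by
        rw [smul_eq_val_toZModPow_smul p hM s z, map_nsmul, AddSubmonoidClass.coe_nsmul])
      (fun z => by
        change ((e (T'.toTopRep.ρ φ₁⁻¹ z) : WeierstrassCurve.geomTorsion W m) :
          WeierstrassCurve.geomPoints W) = _
        rw [he]
        rfl)
      y
  exact singularLocalization_eq_fsLocalization_of_eulerSystem_of_comparisonOp W p S hp2 hc red hred hn hM
    hm e hec he einv hic h₁ h₂ r hq hqr hKol D hD hqD σ hσ hcov hinj hσI hσχ h0 hφ₁ hφ₁q Q hQ.symm hQop
    ΦU' hΦU' ΦU hΦU comm' κ' hκ' comm κ hκ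

end Summit.BirchSwinnertonDyer.Rank1Residual.GaloisImage.Derivative.Rat

end
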